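import Summits.CriticalPhenomena.PercolationContinuityZ3.Theorems.PercNearOneGluingNoHeavyLowerTailQuantitativeCshVertexFunOwnerPocket
import Summits.CriticalPhenomena.PercolationContinuityZ3.Theorems.PercNearOneGluingNoHeavyLowerTailQuantitativeBHKGlauber
import Summits.CriticalPhenomena.PercolationContinuityZ3.Theorems.PercNearOneGluingNoHeavyLowerTailQuantitativeBHKStrict
import Summits.CriticalPhenomena.PercolationContinuityZ3.Theorems.PercNearOneGluingNoHeavyLowerTailCSHDefs
import Summits.CriticalPhenomena.PercolationContinuityZ3.Theorems.PercNearOneGluingAdditiveGluingCSHHpart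
import HarnessLib

/-!
# The strictness locus of van den Berg–Häggström–Kahn's Theorem 1.3 for an ARBITRARY monotone vertex functional against a connection

Support file (`--supports stmt-CriticalPhenomena-4575`), prover seat `prim-rate-mine-2` (lane prim-rate, constants-miner (c), BENCH row
M2-R44; `run/shared/lean/prim/prim-rate/prim-rate-mine-2/PROOFS.md` §P43).  No definitions, no named facts, no sorries; standard axioms.

vdBHK's one-cluster inequality (Thm 1.3) says that, given `D = {x ↮ X}`, increasing functions of the cluster `C_x` are positively correlated; the
denominator-free conditional covariance of `F(C_x)` and `1{o ∈ C_x}` is `covD = μ(D)·∫_{D ∩ {x↔o}} F(C_x) − (∫_D F(C_x))·μ(D ∩ {x↔o}) ≥ 0`.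
Row M2-R16 (`QuantBHK.condCov_openConn_pos_iff`) located its zeros for `F = 1{a ∈ ·}`.  THIS FILE does it for EVERY monotone `F` on vertex
sets (weights `0` off the support `E`, in `(0,1)` on `E`; `x ∉ X`; `o ≠ x`, `o ∉ X`; `E_X` = pairs of `E` missing `X`):

* `QuantBHK.condCov_clusterFun_openConn_pos_iff` — **`0 < covD` iff some pair `e ∈ E_X` is JOINTLY pivotal inside `E_X`: a configuration
  `η ⊆ E_X` with `F(C_x(η ∖ e)) < F(C_x(η ∪ e))`, `x ↔ o` in `η ∪ e` and `x ↮ o` in `η ∖ e`.**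
  ⟸: the Glauber floor `QuantBHK.condCov_ge_glauberTerm` (row M2-R8) at `e` has a positive-weight positive integrand at `η`.
  ⟹: with `K₁` the component of `o` in `(V, E_X) − x` (a pocket hanging off the owner: its `E`-exits end at `x` or in `X`), if NO pair is
  jointly pivotal then `F` is blind to `K₁` on `D` — otherwise, for a configuration `ω ⊆ E` of `D` with `F(C_x ω ∖ K₁) < F(C_x ω)`, the cluster
  enters `K₁` through a pair `e* = xu`, and `e*` is jointly pivotal at `η = (pairs of ω missing X, not joining x to K₁) ∪ (pairs of E inside K₁)`:
  `C_x(η) ⊆ C_x ω ∖ K₁ ∌ o` and `C_x(η ∪ e*) ⊇ C_x ω ∪ K₁ ∋ o` — and a blind `F` has `covD = 0` by the factorisation at the owner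
  `QuantBHK.covD_eq_zero_of_ownerPocket` (row M2-R36 Case I).
* `CSH.covD_clusterFun_pos_iff` — the same in the `CSH.covD` currency of the hierarchy (`f = F ∘ V`), the form consumed by the GEN zero set
  (`…QuantitativeGenZeroSet`: it is the third term of the GEN peeling identity `CSH.surplus_peel_top`).
[cite: VandenbergHaggstromKahn2005, Thm. 1.3 (p. 6), §2.1 (pp. 9–13)] [cite: Grimmett1999, §2.2]
-/

noncomputable section

namespace Summit.CriticalPhenomena.PercolationContinuityZ3.Theorems

open MeasureTheory Set Literature.Probability.LatticeModels Literature.Probability.Percolation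
open Literature.Probability.Percolation.BHK2006 (weight weight_nonneg integral_prodBernoulli_eq_sum)
open scoped Classical

namespace QuantBHK

universe v

variable {V : Type v} [Fintype V]

omit [Fintype V] in
/-- A vertex set closed under the open pairs issuing from it contains the whole cluster of each of its vertices. [folklore] -/
theorem mem_of_reachable_of_closed {ζ : Set (Sym2 V)} {S : Set V} (hS : ∀ p q : V, s(p, q) ∈ ζ → p ∈ S → q ∈ S)
    {a c : V} (h : (openGraph ζ).Reachable a c) (ha : a ∈ S) : c ∈ S := by
  obtain ⟨W⟩ := h
  induction W with
  | nil => exact ha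
  | cons hadj W ih =>
    rw [openGraph_adj] at hadj
    exact ih (hS _ _ hadj.1 ha)

/-- **Strictness locus of vdBHK Thm 1.3 for a monotone vertex functional against a connection.**  Weights non-degenerate on the support `E`;
`x ∉ X`; `o ≠ x`, `o ∉ X`; `F` monotone on vertex sets; `D = {x ↮ X}`.  Then
`0 < μ(D)·∫_{D ∩ {x↔o}} F(C_x) − (∫_D F(C_x))·μ(D ∩ {x↔o})` iff some pair of `E` missing `X` is jointly pivotal, at a configuration of
pairs of `E` missing `X`, for `F(C_x)` (strictly) and for `{x ↔ o}`.
[cite: VandenbergHaggstromKahn2005, Thm. 1.3 (p. 6), §2.1 (pp. 9–13)] -/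
theorem condCov_clusterFun_openConn_pos_iff (w : Sym2 V → unitInterval) (E : Set (Sym2 V))
    (hE0 : ∀ f, f ∉ E → (w f : ℝ) = 0) (hE1 : ∀ f ∈ E, 0 < (w f : ℝ) ∧ (w f : ℝ) < 1)
    (x : V) (X : Set V) (o : V) (hxX : x ∉ X) (hox : o ≠ x) (hoX : o ∉ X)
    (F : Set V → ℝ) (hF : ∀ S S' : Set V, S ⊆ S' → F S ≤ F S') :
    0 < (prodBernoulli w).real {ω : BondConfig V | ∀ y ∈ X, ¬ (openGraph ω).Reachable x y} *
          (∫ ω in {ω : BondConfig V | ∀ y ∈ X, ¬ (openGraph ω).Reachable x y} ∩ openConn x o, F (openCluster ω x) ∂(prodBernoulli w)) -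
        (∫ ω in {ω : BondConfig V | ∀ y ∈ X, ¬ (openGraph ω).Reachable x y}, F (openCluster ω x) ∂(prodBernoulli w)) *
          (prodBernoulli w).real ({ω : BondConfig V | ∀ y ∈ X, ¬ (openGraph ω).Reachable x y} ∩ openConn x o) ↔
      ∃ e ∈ E, (∀ y ∈ X, y ∉ e) ∧ ∃ η : Set (Sym2 V), η ⊆ {f | f ∈ E ∧ ∀ y ∈ X, y ∉ f} ∧
        F (openCluster (η \ {e}) x) < F (openCluster (insert e η) x) ∧
        insert e η ∈ (openConn x o : Set (BondConfig V)) ∧ η \ {e} ∉ (openConn x o : Set (BondConfig V)) := by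
  set μ := prodBernoulli w with hμ
  set D : Set (BondConfig V) := {ω : BondConfig V | ∀ y ∈ X, ¬ (openGraph ω).Reachable x y} with hD
  set EX : Set (Sym2 V) := {f | f ∈ E ∧ ∀ y ∈ X, y ∉ f} with hEX
  have hmeas : ∀ S : Set (BondConfig V), MeasurableSet S := fun _ => MeasurableSet.of_discrete
  have hw0 : ∀ f, 0 ≤ (w f : ℝ) := fun f => (w f).2.1
  have hw1 : ∀ f, (w f : ℝ) ≤ 1 := fun f => (w f).2.2
  have hw1' : ∀ f, w f < 1 := by
    intro f
    by_cases hf : f ∈ E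
    · exact_mod_cast (hE1 f hf).2
    · have h0 := hE0 f hf
      exact_mod_cast (show (w f : ℝ) < 1 by rw [h0]; norm_num)
  have hFm : Monotone F := fun S S' h => hF S S' h
  -- configurations of pairs missing `X` lie in `D`
  have hDX : ∀ ζ : Set (Sym2 V), (∀ f ∈ ζ, ∀ y ∈ X, y ∉ f) → ζ ∈ D := by
    intro ζ hζ y hy hxy
    have := eq_of_reachable_of_forall_notMem (S := ζ) (x := y) (y := x) (fun f hf => hζ f hf y hy) hxy.symm
    exact hxX (this ▸ hy)
  -- monotonicity of the cluster in the configuration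
  have hCmono : ∀ ζ ζ' : Set (Sym2 V), ζ ⊆ ζ' → openCluster ζ x ⊆ openCluster ζ' x :=
    fun ζ ζ' h c hc => SimpleGraph.Reachable.mono (BHK2006.openGraph_le h) hc
  constructor
  swap
  · -- ⟸: the Glauber floor at `e` is positive
    rintro ⟨e, heE, heX, η, hη, hFlt, ho1, ho0⟩
    set G : Set V → ℝ := fun S => if o ∈ S then 1 else 0 with hG
    have hGm : Monotone G := by
      intro S S' h
      simp only [hG]
      by_cases hS : o ∈ S
      · rw [if_pos hS, if_pos (h hS)]
      · rw [if_neg hS]; split_ifs <;> norm_num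
    have hgl := condCov_ge_glauberTerm w x X e F G hFm hGm
    -- identify the right side of the Glauber floor with the conditional covariance of the statement
    have hFG : (fun ω : BondConfig V => F (openCluster ω x) * G (openCluster ω x)) =
        (openConn x o : Set (BondConfig V)).indicator (fun ω => F (openCluster ω x)) := by
      funext ω
      by_cases hω : ω ∈ (openConn x o : Set (BondConfig V))
      · rw [indicator_of_mem hω]
        simp only [hG, if_pos (show o ∈ openCluster ω x from hω), mul_one]
      · rw [indicator_of_notMem hω]
        simp only [hG, if_neg (show o ∉ openCluster ω x from hω), mul_zero]
    have hG1 : (fun ω : BondConfig V => G (openCluster ω x)) = (openConn x o : Set (BondConfig V)).indicator (fun _ => (1 : ℝ)) := by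
      funext ω
      by_cases hω : ω ∈ (openConn x o : Set (BondConfig V))
      · rw [indicator_of_mem hω]; simp only [hG, if_pos (show o ∈ openCluster ω x from hω)]
      · rw [indicator_of_notMem hω]; simp only [hG, if_neg (show o ∉ openCluster ω x from hω)]
    have hI1 : ∫ ω in D, F (openCluster ω x) * G (openCluster ω x) ∂μ = ∫ ω in D ∩ openConn x o, F (openCluster ω x) ∂μ := by
      rw [show (fun ω : BondConfig V => F (openCluster ω x) * G (openCluster ω x)) =
          (openConn x o : Set (BondConfig V)).indicator (fun ω => F (openCluster ω x)) from hFG, setIntegral_indicator (hmeas _)]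
    have hI2 : ∫ ω in D, G (openCluster ω x) ∂μ = μ.real (D ∩ openConn x o) := by
      rw [show (fun ω : BondConfig V => G (openCluster ω x)) = (openConn x o : Set (BondConfig V)).indicator (fun _ => (1 : ℝ)) from hG1,
        setIntegral_indicator (hmeas _), setIntegral_const, smul_eq_mul, mul_one]
    rw [hI1, hI2] at hgl
    refine lt_of_lt_of_le ?_ hgl
    -- positivity of the floor
    have hDpos : 0 < μ.real D := by
      refine CSH.prodBernoulli_real_pos_of_empty_mem w hw1' ?_
      intro y hy h
      rw [HullPort.reachable_empty_iff] at h
      exact hxX (h ▸ hy)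
    have hwe : 0 < (w e : ℝ) * (1 - w e) := mul_pos (hE1 e heE).1 (by linarith [(hE1 e heE).2])
    refine mul_pos hDpos (mul_pos hwe ?_)
    rw [integral_prodBernoulli_eq_sum]
    -- every term is nonnegative, the term at `η` is positive
    have hterm_nn : ∀ ω : Set (Sym2 V), 0 ≤ weight (fun f => (w f : ℝ)) ω *
        (D.indicator (fun _ => (1 : ℝ)) (insert e ω) *
          ((F (openCluster (insert e ω) x) - F (openCluster (ω \ {e}) x)) *
            (G (openCluster (insert e ω) x) - G (openCluster (ω \ {e}) x)))) := by
      intro ω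
      have hsub : ω \ {e} ⊆ insert e ω := sdiff_subset.trans (subset_insert e ω)
      refine mul_nonneg (weight_nonneg hw0 hw1 ω) (mul_nonneg (indicator_nonneg (fun _ _ => zero_le_one) _) (mul_nonneg ?_ ?_))
      · exact sub_nonneg.2 (hF _ _ (hCmono _ _ hsub))
      · exact sub_nonneg.2 (hGm (hCmono _ _ hsub))
    have hwη : 0 < weight (fun f => (w f : ℝ)) η := by
      refine Finset.prod_pos fun f _ => ?_
      split_ifs with hf
      · exact (hE1 f (hη hf).1).1
      · linarith [show (w f : ℝ) < 1 from by exact_mod_cast hw1' f]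
    have hηD : insert e η ∈ D := by
      refine hDX _ fun f hf y hy => ?_
      rcases mem_insert_iff.1 hf with rfl | hf
      · exact heX y hy
      · exact (hη hf).2 y hy
    have hterm_pos : 0 < weight (fun f => (w f : ℝ)) η *
        (D.indicator (fun _ => (1 : ℝ)) (insert e η) *
          ((F (openCluster (insert e η) x) - F (openCluster (η \ {e}) x)) *
            (G (openCluster (insert e η) x) - G (openCluster (η \ {e}) x)))) := by
      rw [indicator_of_mem hηD, one_mul]
      refine mul_pos hwη (mul_pos (sub_pos.2 hFlt) ?_)
      simp only [hG, if_pos (show o ∈ openCluster (insert e η) x from ho1), if_neg (show o ∉ openCluster (η \ {e}) x from ho0)]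
      norm_num
    exact lt_of_lt_of_le hterm_pos (Finset.single_le_sum (fun ω _ => hterm_nn ω) (Finset.mem_univ η))
  · -- ⟹ (contrapositive): no jointly pivotal pair ⟹ `F` is blind to the pocket `K₁` ⟹ the covariance vanishes
    intro hpos
    by_contra H
    set E' : Set (Sym2 V) := {f | f ∈ E ∧ (∀ y ∈ X, y ∉ f) ∧ x ∉ f} with hE'
    set K₁ : Set V := {c | (openGraph E').Reachable o c} with hK₁
    have hoK : o ∈ K₁ := SimpleGraph.Reachable.refl o
    have hxK : x ∉ K₁ := by
      intro h
      have := eq_of_reachable_of_forall_notMem (S := E') (x := x) (y := o) (fun f hf => hf.2.2) (SimpleGraph.Reachable.symm h)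
      exact hox this
    have hXK : ∀ y ∈ X, y ∉ K₁ := by
      intro y hy h
      have := eq_of_reachable_of_forall_notMem (S := E') (x := y) (y := o) (fun f hf => hf.2.1 y hy) (SimpleGraph.Reachable.symm h)
      exact hoX (this ▸ hy)
    have hK : ∀ p q : V, s(p, q) ∈ E → p ∈ K₁ → q ∈ K₁ ∨ q = x ∨ q ∈ X := by
      intro p q hpq hp
      by_cases hqx : q = x
      · exact Or.inr (Or.inl hqx)
      by_cases hqX : q ∈ X
      · exact Or.inr (Or.inr hqX)
      by_cases hpq' : p = q
      · exact Or.inl (hpq' ▸ hp)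
      left
      have hadj : (openGraph E').Adj p q := by
        rw [openGraph_adj]
        refine ⟨⟨hpq, fun y hy hyf => ?_, fun hxf => ?_⟩, hpq'⟩
        · rcases Sym2.mem_iff.1 hyf with rfl | rfl
          · exact hXK _ hy hp
          · exact hqX hy
        · rcases Sym2.mem_iff.1 hxf with h | h
          · exact hxK (h ▸ hp)
          · exact hqx h.symm
      exact SimpleGraph.Reachable.trans hp hadj.reachable
    -- the pocket is connected through the pairs of `E` inside it
    have hKconn : ∀ c ∈ K₁, ∀ ζ : Set (Sym2 V), (∀ f ∈ E, (∀ z ∈ f, z ∈ K₁) → f ∈ ζ) → (openGraph ζ).Reachable o c := by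
      intro c hc ζ hζ
      obtain ⟨W⟩ := (show (openGraph E').Reachable o c from hc)
      refine reachable_of_walk_edges_subset W fun g hg => hζ g (mem_and_not_isDiag_of_mem_edges W hg).1.1 fun z hz => ?_
      exact (W.takeUntil z (SimpleGraph.Walk.mem_support_of_mem_edges hg hz)).reachable
    -- blindness of `F` to `K₁` on `D`
    have hFK : ∀ ω : Set (Sym2 V), ω ⊆ E → (∀ y ∈ X, ¬ (openGraph ω).Reachable x y) →
        F (openCluster ω x \ K₁) = F (openCluster ω x) := by
      intro ω hωE hωD
      by_contra hne
      set C : Set V := openCluster ω x with hC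
      have hlt : F (C \ K₁) < F C := lt_of_le_of_ne (hF _ _ sdiff_subset) hne
      have hCX : ∀ c ∈ C, c ∉ X := fun c hc hcX => hωD c hcX hc
      have hxC : x ∈ C := SimpleGraph.Reachable.refl x
      -- the cluster meets the pocket
      obtain ⟨c, hcC, hcK⟩ : ∃ c, c ∈ C ∧ c ∈ K₁ := by
        by_contra h'
        push Not at h'
        have : C \ K₁ = C := Set.ext fun c => ⟨fun h => h.1, fun h => ⟨h, h' c h⟩⟩
        exact hne (by rw [this])
      -- the pair `e* = xu` through which it enters
      obtain ⟨W⟩ := (show (openGraph ω).Reachable x c from hcC)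
      obtain ⟨d, hd, hd1, hd2⟩ := W.exists_boundary_dart (K₁ᶜ) hxK (fun h => h hcK)
      have hd2' : d.snd ∈ K₁ := not_notMem.1 hd2
      have hdadj := d.adj
      rw [openGraph_adj] at hdadj
      have hpC : d.fst ∈ C := (W.takeUntil d.fst (SimpleGraph.Walk.dart_fst_mem_support_of_mem_darts W hd)).reachable
      have hpx : d.fst = x := by
        rcases hK d.snd d.fst (by rw [Sym2.eq_swap]; exact hωE hdadj.1) hd2' with h | h | h
        · exact absurd h hd1
        · exact h
        · exact absurd h (hCX _ hpC)
      set u : V := d.snd with hu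
      have heω : s(x, u) ∈ ω := hpx ▸ hdadj.1
      have hxu : x ≠ u := fun h => hxK (h ▸ hd2')
      -- the jointly pivotal configuration
      set η : Set (Sym2 V) := {f | f ∈ ω ∧ (∀ y ∈ X, y ∉ f) ∧ (x ∈ f → ∀ z ∈ f, z ∉ K₁)} ∪ {f | f ∈ E ∧ ∀ z ∈ f, z ∈ K₁} with hη
      have hηEX : η ⊆ EX := by
        rintro f (⟨hfω, hfX, -⟩ | ⟨hfE, hfK⟩)
        · exact ⟨hωE hfω, hfX⟩
        · exact ⟨hfE, fun y hy hyf => hXK y hy (hfK y hyf)⟩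
      have heη : s(x, u) ∉ η := by
        rintro (⟨-, -, h⟩ | ⟨-, h⟩)
        · exact h (Sym2.mem_mk_left _ _) u (Sym2.mem_mk_right _ _) hd2'
        · exact hxK (h x (Sym2.mem_mk_left _ _))
      have hηdiff : η \ {s(x, u)} = η := sdiff_singleton_eq_self heη
      -- below `e*`: everything reachable from `x` in `η` avoids `K₁`, and stays inside `C`
      have hclosed1 : ∀ p q : V, s(p, q) ∈ η → p ∈ K₁ᶜ → q ∈ K₁ᶜ := by
        rintro p q (⟨hfω, hfX, hfx⟩ | ⟨hfE, hfK⟩) hp hq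
        · rcases hK q p (by rw [Sym2.eq_swap]; exact hωE hfω) hq with h | h | h
          · exact hp h
          · exact hfx (h ▸ Sym2.mem_mk_left _ _) q (Sym2.mem_mk_right _ _) hq
          · exact hfX p h (Sym2.mem_mk_left _ _)
        · exact hp (hfK p (Sym2.mem_mk_left _ _))
      have hclosed2 : ∀ p q : V, s(p, q) ∈ η → p ∈ C \ K₁ → q ∈ C \ K₁ := by
        intro p q hf hp
        refine ⟨?_, hclosed1 p q hf hp.2⟩
        rcases hf with ⟨hfω, -, -⟩ | ⟨-, hfK⟩
        · by_cases hpq : p = q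
          · exact hpq ▸ hp.1
          · have hadj : (openGraph ω).Adj p q := by rw [openGraph_adj]; exact ⟨hfω, hpq⟩
            exact SimpleGraph.Reachable.trans hp.1 hadj.reachable
        · exact absurd (hfK p (Sym2.mem_mk_left _ _)) hp.2
      have hlow : openCluster η x ⊆ C \ K₁ := fun c' hc' => mem_of_reachable_of_closed hclosed2 hc' ⟨hxC, hxK⟩
      have ho0 : η ∉ (openConn x o : Set (BondConfig V)) := fun h => (hlow h).2 hoK
      -- above `e*`: the pocket and the cluster are reached
      have hKup : K₁ ⊆ openCluster (insert s(x, u) η) x := by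
        intro c' hc'
        have hxu' : (openGraph (insert s(x, u) η)).Reachable x u := by
          refine SimpleGraph.Adj.reachable ?_
          rw [openGraph_adj]; exact ⟨mem_insert _ _, hxu⟩
        have hι : ∀ f ∈ E, (∀ z ∈ f, z ∈ K₁) → f ∈ insert s(x, u) η := fun f hfE hfK => mem_insert_of_mem _ (Or.inr ⟨hfE, hfK⟩)
        exact hxu'.trans ((hKconn u hd2' _ hι).symm.trans (hKconn c' hc' _ hι))
      have ho1 : insert s(x, u) η ∈ (openConn x o : Set (BondConfig V)) := hKup hoK
      have hclosed3 : ∀ p q : V, s(p, q) ∈ ω → p ∈ openCluster (insert s(x, u) η) x ∩ C → q ∈ openCluster (insert s(x, u) η) x ∩ C := by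
        intro p q hf hp
        by_cases hpq : p = q
        · exact hpq ▸ hp
        have hqC : q ∈ C := by
          have hadj : (openGraph ω).Adj p q := by rw [openGraph_adj]; exact ⟨hf, hpq⟩
          exact SimpleGraph.Reachable.trans hp.2 hadj.reachable
        refine ⟨?_, hqC⟩
        have hfX : ∀ y ∈ X, y ∉ s(p, q) := by
          intro y hy hyf
          rcases Sym2.mem_iff.1 hyf with rfl | rfl
          · exact hCX _ hp.2 hy
          · exact hCX _ hqC hy
        by_cases hxK' : x ∈ s(p, q) ∧ ∃ z ∈ s(p, q), z ∈ K₁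
        · -- an `x`–`K₁` pair: both ends are reached
          obtain ⟨hxf, z, hzf, hzK⟩ := hxK'
          rcases Sym2.mem_iff.1 (show q ∈ s(p, q) from Sym2.mem_mk_right _ _) with h | h
          · -- impossible branch kept for uniformity
            exact h ▸ hp.1
          · rcases Sym2.mem_iff.1 hzf with hz | hz
            · -- `z = p ∈ K₁`, so `q = x` or `q ∈ K₁`
              rcases Sym2.mem_iff.1 hxf with hx' | hx'
              · exact absurd (hx' ▸ hz ▸ hzK) hxK
              · exact hx' ▸ SimpleGraph.Reachable.refl x
            · exact hKup (hz ▸ hzK)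
        · have hfη : s(p, q) ∈ insert s(x, u) η := by
            refine mem_insert_of_mem _ (Or.inl ⟨hf, hfX, fun hxf z hzf hzK => hxK' ⟨hxf, z, hzf, hzK⟩⟩)
          have hadj : (openGraph (insert s(x, u) η)).Adj p q := by rw [openGraph_adj]; exact ⟨hfη, hpq⟩
          exact SimpleGraph.Reachable.trans hp.1 hadj.reachable
      have hCup : C ⊆ openCluster (insert s(x, u) η) x := fun c' hc' =>
        (mem_of_reachable_of_closed hclosed3 hc' ⟨SimpleGraph.Reachable.refl x, hxC⟩).1
      -- contradiction with `H`
      refine H ⟨s(x, u), hωE heω, ?_, η, hηEX, ?_, ho1, by rw [hηdiff]; exact ho0⟩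
      · intro y hy hyf
        rcases Sym2.mem_iff.1 hyf with rfl | rfl
        · exact hxX hy
        · exact hXK _ hy hd2'
      · rw [hηdiff]
        exact lt_of_le_of_lt (hF _ _ hlow) (lt_of_lt_of_le hlt (hF _ _ hCup))
    have hzero := covD_eq_zero_of_ownerPocket w E hE0 x X K₁ hxK hXK hxX hK F hFK o hoK
    simp only [← hμ, ← hD] at hzero hpos
    rw [hzero] at hpos
    linarith

end QuantBHK

namespace CSH

variable {V : Type*} [Fintype V]

/-- **The same locus in the `CSH.covD` currency** (`f = F ∘ V`, the functional of the (S5) peeling): weights non-degenerate on `E`, `x ∉ X`,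
`o ≠ x`, `o ∉ X`, `F` monotone on vertex sets:  `0 < covD w x X (F ∘ V) o` iff some pair of `E` missing `X` is jointly pivotal inside the pairs
of `E` missing `X` for `F(C_x)` and `{x ↔ o}`. [cite: VandenbergHaggstromKahn2005, Thm. 1.3 (p. 6), §2.1 (pp. 9–13)] -/
theorem covD_clusterFun_pos_iff (w : Sym2 V → unitInterval) (E : Set (Sym2 V))
    (hE0 : ∀ f, f ∉ E → (w f : ℝ) = 0) (hE1 : ∀ f ∈ E, 0 < (w f : ℝ) ∧ (w f : ℝ) < 1)
    (x : V) (X : Set V) (o : V) (hxX : x ∉ X) (hox : o ≠ x) (hoX : o ∉ X)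
    (F : Set V → ℝ) (hF : ∀ S S' : Set V, S ⊆ S' → F S ≤ F S') :
    0 < covD w x X (fun C => F {a | a = x ∨ ∃ e ∈ C, a ∈ e}) o ↔
      ∃ e ∈ E, (∀ y ∈ X, y ∉ e) ∧ ∃ η : Set (Sym2 V), η ⊆ {f | f ∈ E ∧ ∀ y ∈ X, y ∉ f} ∧
        F (openCluster (η \ {e}) x) < F (openCluster (insert e η) x) ∧
        insert e η ∈ (openConn x o : Set (BondConfig V)) ∧ η \ {e} ∉ (openConn x o : Set (BondConfig V)) := by
  have hfx : ∀ ζ : BondConfig V, F {a | a = x ∨ ∃ e ∈ openEdgeCluster ζ x, a ∈ e} = F (openCluster ζ x) := by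
    intro ζ; rw [KNPreFKG.openCluster_eq_setOf_openEdgeCluster]
  simp only [covD, hfx]
  exact QuantBHK.condCov_clusterFun_openConn_pos_iff w E hE0 hE1 x X o hxX hox hoX F hF

end CSH

end Summit.CriticalPhenomena.PercolationContinuityZ3.Theorems

end
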